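import Summits.NavierStokesRegularity.OSWSelfSimilar.OSWMechanism01
import HarnessLib

/-!
# OSW self-similar mechanism: local theory at the antipode, quantisation, the a → 1 branch (MECHANISM.md §§1–28: THEOREMS M1–M31) — part 02 of 26

1-D model (gCLM/OSW), computer-assisted; not Euler/NS.  Filed under `Summits/NavierStokesRegularity/OSWSelfSimilar/` by a prover-role courier on behalf of the
mechanism seat pub-oswblow-mech (planner-pub-oswblow-mech-g29-0), cell pub-oswblow (host summit NavierStokesRegularity); the gate admits the path but
not role planner.  CONTENT = the staged transcript `pub-oswblow-mech/lean/OSWMechanism.lean` (sha256 9c32c87eb2d21b32…,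
8958 lines), source lines 374–734, UNCHANGED except: (i) namespace prefix `OSWSelfSimilar.Mechanism` → `Summit.NavierStokesRegularity.OSWSelfSimilar.Mechanism`;
(ii) the frames open at the cut (section (anonymous) › namespace Summit.NavierStokesRegularity.OSWSelfSimilar.Mechanism) are re-opened above the body with their `open` commands replayed, and closed
at the end; (iii) this docstring.  Generated by `pub-oswblow-mech/lean/courier/make_split.py`; the parts must be filed IN ORDER
(each imports its predecessor).  First/last declarations here: `M5NonIntegerStatement` … `M10IffStatement` (26 in this part).
AI-written transcript; kernel-checked on the farm as ONE file before splitting (see the kit's CHECKS); to be checked, not trusted.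
-/

noncomputable section
open Complex Set Filter
open scoped Topology
open Literature.Analysis.FluidPDE.OkamotoSakajoWunsch2008
namespace Summit.NavierStokesRegularity.OSWSelfSimilar.Mechanism

/-- **Theorem M5 (i): `1/α ∉ ℕ` ⇒ exactly `C^{⌊1/α⌋, {1/α}}` through infinity** — MECHANISM.md §10.4,
not kernel-checked. -/
def M5NonIntegerStatement : Prop :=
  ∀ (α a : ℝ) (c : ℤ → ℂ), LineChartHyp α a c →
    (∀ m : ℕ, 1 / α ≠ m) →
    let s := 1 / α
    let n := Nat.floor s
    (∃ (ε : ℝ) (K : NNReal), 0 < ε ∧ ContDiffOn ℝ (n : ℕ∞) (fR c) (nearPi ε) ∧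
        HolderOnWith K (Real.toNNReal (s - n)) (iteratedDeriv n (fR c)) (nearPi ε)) ∧
    (∀ θ' : NNReal, s - n < (θ' : ℝ) → (θ' : ℝ) ≤ 1 →
      ∀ (ε : ℝ) (K : NNReal), 0 < ε →
        ¬ HolderOnWith K θ' (iteratedDeriv n (fR c)) (nearPi ε))

/-- **Theorem M5 (iii): `1/α = 2m` ⇒ `C^{2m-1,1}` but not `C^{2m}` through infinity** —
MECHANISM.md §10.4, not kernel-checked. -/
def M5EvenStatement : Prop :=
  ∀ (α a : ℝ) (c : ℤ → ℂ), LineChartHyp α a c →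
    ∀ m : ℕ, 1 ≤ m → 1 / α = 2 * (m : ℝ) →
    (∃ (ε : ℝ) (K : NNReal), 0 < ε ∧ ContDiffOn ℝ ((2 * m - 1 : ℕ) : ℕ∞) (fR c) (nearPi ε) ∧
        LipschitzOnWith K (iteratedDeriv (2 * m - 1) (fR c)) (nearPi ε)) ∧
    ∀ ε : ℝ, 0 < ε → ¬ ContDiffOn ℝ ((2 * m : ℕ) : ℕ∞) (fR c) (nearPi ε)

/-- The v3 mirror-mechanism statement (MECHANISM.md §10): conjunction for citation by name. -/
def MirrorMechanismStatement : Prop :=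
  StructureAtInfinityStatement ∧ M5NonIntegerStatement ∧ M5OddStatement ∧ M5EvenStatement ∧
    M5OneStatement ∧ M6Statement ∧ M6SharpStatement

/-- Kernel-checked algebra behind MECHANISM.md §10.5(1): inserting `Φ = c ξ/(1+ξ²)²` into the
similarity equation on `ℝ` gives three coefficient equations, whose unique solution is the classical
`a = 1/2` closed form (`α = 1/3`, `c = -16/3`). -/
theorem rung_three_coefficients (α a c : ℝ) :
    (1 - 3 * α = 0 ∧ 2 - 2 * α + c / 2 * (3 * a - 1) = 0 ∧ 1 + α + c / 2 * (1 - a) = 0) ↔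
      (α = 1 / 3 ∧ a = 1 / 2 ∧ c = -16 / 3) := by
  constructor
  · rintro ⟨h1, h2, h3⟩
    have hα : α = 1 / 3 := by linarith
    have key : c / 2 * (4 * a - 2) = 0 := by linear_combination h2 - h3 - h1
    rcases mul_eq_zero.mp key with hc | ha
    · exfalso
      have hc0 : c = 0 := by linarith
      subst hc0
      norm_num at h3
      linarith
    · have ha' : a = 1 / 2 := by linarith
      subst ha'
      subst hα
      refine ⟨rfl, rfl, ?_⟩
      norm_num at h3
      linarith
  · rintro ⟨rfl, rfl, rfl⟩
    norm_num

/-- Kernel-checked algebra behind MECHANISM.md §10.5(2): the pole ansatz `Φ = c ξ/(1+ξ²)³` (the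
would-be rational `α = 1/5` rung) gives four coefficient equations with no solution — there is no third
rational closed form (cf. LSS 2021, Thm 3). -/
theorem no_rational_rung_five :
    ¬ ∃ α a c : ℝ, 1 - 5 * α = 0 ∧ 6 / 5 + c / 8 * (5 * a - 1) = 0 ∧
        12 / 5 + c / 4 * (7 * a - 3) = 0 ∧ 6 / 5 + 3 * c / 8 * (1 - a) = 0 := by
  rintro ⟨α, a, c, _h1, h2, h3, h4⟩
  have key : c * (1 - a) = 0 := by linear_combination 4 * h2 - 2 * h3
  have h65 : (6 : ℝ) / 5 = 0 := by linear_combination h4 - (3 / 8 : ℝ) * key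
  norm_num at h65

/-! ### Kernel-checked algebra and the bridge to `HasAntipodalOrder` -/

/-- The quantisation condition is explicit algebra: `p = 2n+1 ↔ Hf(π) = -1/((2n+1)a-1)` whenever
`a ≠ 0` and `(2n+1)a ≠ 1` (so `M2CorollaryStatement` follows from `M2Statement`). -/
theorem exponent_odd_iff (a H : ℝ) (n : ℕ) (ha : a ≠ 0)
    (hna : (2 * (n : ℝ) + 1) * a - 1 ≠ 0) :
    (1 - 1 / H) / a = 2 * (n : ℝ) + 1 ↔ H = -1 / ((2 * (n : ℝ) + 1) * a - 1) := by
  have hD : 1 - (2 * (n : ℝ) + 1) * a ≠ 0 := by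
    intro h0
    apply hna
    linarith
  constructor
  · intro h
    have h1 : 1 - 1 / H = (2 * (n : ℝ) + 1) * a := (div_eq_iff ha).mp h
    have h2 : 1 / H = 1 - (2 * (n : ℝ) + 1) * a := by linarith
    have h3 : H = 1 / (1 - (2 * (n : ℝ) + 1) * a) := by
      rw [← h2, one_div_one_div]
    rw [h3, div_eq_div_iff hD hna]
    ring
  · intro h
    rw [div_eq_iff ha, h]
    field_simp
    ring

/-- "`Λ(a) = 0` iff `p(a)` is odd" is algebra once `C ≠ 0` (Lemma 2.2) and `p > 0`: the factor that
vanishes is `cos(πp/2)`.  (The analysis — that `Λ` IS the tail constant — is Prop. 4.4 / Theorem M4.) -/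
theorem tailConstant_eq_zero_iff {C p : ℝ} (hC : C ≠ 0) (hp : 0 < p) :
    tailConstant C p = 0 ↔ ∃ n : ℕ, p = 2 * (n : ℝ) + 1 := by
  have hπ : (2 / Real.pi : ℝ) ≠ 0 := div_ne_zero two_ne_zero Real.pi_ne_zero
  have hΓ : Real.Gamma (p + 1) ≠ 0 := (Real.Gamma_pos_of_pos (by linarith)).ne'
  unfold tailConstant
  constructor
  · intro h
    have hcos : Real.cos (Real.pi * p / 2) = 0 := by
      rcases mul_eq_zero.mp h with h1 | h1
      · rcases mul_eq_zero.mp h1 with h2 | h2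
        · rcases mul_eq_zero.mp h2 with h3 | h3
          · exact absurd h3 hπ
          · exact absurd h3 hC
        · exact absurd h2 hΓ
      · exact h1
    obtain ⟨k, hk⟩ := Real.cos_eq_zero_iff.mp hcos
    have h2 : Real.pi * p = Real.pi * (2 * (k : ℝ) + 1) := by linarith
    have hpk : p = 2 * (k : ℝ) + 1 := mul_left_cancel₀ Real.pi_ne_zero h2
    have hk0 : 0 ≤ k := by
      by_contra hneg
      have hneg' : k < 0 := not_le.mp hneg
      have h1 : k + 1 ≤ 0 := Int.lt_iff_add_one_le.mp hneg'
      have h3 : (k : ℝ) + 1 ≤ 0 := by exact_mod_cast h1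
      linarith
    refine ⟨k.toNat, ?_⟩
    have hcast : ((k.toNat : ℕ) : ℝ) = (k : ℝ) := by
      have := Int.toNat_of_nonneg hk0
      exact_mod_cast this
    rw [hcast]
    exact hpk
  · rintro ⟨n, rfl⟩
    have : Real.cos (Real.pi * (2 * (n : ℝ) + 1) / 2) = 0 := by
      rw [Real.cos_eq_zero_iff]
      exact ⟨n, by push_cast; ring⟩
    rw [this, mul_zero]

/-- For odd `P`, `sgn(y)·|y|^P = y^P`. -/
theorem sign_mul_abs_pow_of_odd {P : ℕ} (hP : Odd P) (y : ℝ) :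
    Real.sign y * |y| ^ P = y ^ P := by
  rcases lt_trichotomy y 0 with hy | hy | hy
  · rw [Real.sign_of_neg hy, abs_of_neg hy, hP.neg_pow]
    ring
  · subst hy
    simp [Real.sign_zero, hP.pos.ne']
  · rw [Real.sign_of_pos hy, abs_of_pos hy]
    ring

/-- **Bridge (kernel-checked):** the structure `f(π+y) = C·sgn(y)·|y|^P·E(y)` of Lemma 2.2 with an ODD
INTEGER exponent `P`, `C ≠ 0`, `E` continuous near `0` with `E 0 = 1`, gives the landed predicate
`HasAntipodalOrder c P` (vanishing order exactly `P` at the antipode) with `κ = C`.  So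
`StructureStatement ∧ (p(a) = P odd)` feeds the cell's target vocabulary directly. -/
theorem hasAntipodalOrder_of_structure {c : ℤ → ℂ} {C δ : ℝ} {E : ℝ → ℝ} {P : ℕ} (hP : Odd P)
    (hC : C ≠ 0) (hδ : 0 < δ) (hE : ContinuousOn E (Ioo (-δ) δ)) (hE0 : E 0 = 1)
    (hf : ∀ y : ℝ, |y| < δ →
      (fourierEval c (Real.pi + y)).re = C * Real.sign y * |y| ^ ((P : ℕ) : ℝ) * E y) :
    HasAntipodalOrder c P := by
  refine ⟨C, hC, ?_⟩
  have hEt : Tendsto E (𝓝 0) (𝓝 1) := by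
    have h := (hE.continuousAt (Ioo_mem_nhds (by linarith) hδ)).tendsto
    rwa [hE0] at h
  have hlim : Tendsto (fun y : ℝ => C * E y) (𝓝[≠] 0) (𝓝 C) := by
    have h := (hEt.mono_left (nhdsWithin_le_nhds (s := ({(0 : ℝ)}ᶜ : Set ℝ)))).const_mul C
    simpa using h
  refine hlim.congr' ?_
  filter_upwards [inter_mem_nhdsWithin ({(0 : ℝ)}ᶜ) (Ioo_mem_nhds (show -δ < 0 by linarith) hδ)]
    with y hy
  obtain ⟨hy0, hyI⟩ := hy
  have hy0' : y ≠ 0 := hy0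
  have hyabs : |y| < δ := abs_lt.mpr ⟨hyI.1, hyI.2⟩
  rw [hf y hyabs, Real.rpow_natCast]
  have hkey : Real.sign y * |y| ^ P = y ^ P := sign_mul_abs_pow_of_odd hP y
  have hyP : y ^ P ≠ 0 := pow_ne_zero _ hy0'
  rw [eq_div_iff hyP, show C * Real.sign y * |y| ^ P * E y = C * (Real.sign y * |y| ^ P) * E y by ring,
    hkey]
  ring

/-- Sanity check of the exponent formula: with `Hf(π) = -1/(3a-1)` the exponent is `3`
(the `n = 1` instance of `exponent_odd_iff`, by direct computation). -/
example (a : ℝ) (ha : a ≠ 0) (_h3 : 3 * a - 1 ≠ 0) :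
    (1 - 1 / (-1 / (3 * a - 1))) / a = 3 := by
  rw [div_eq_iff ha]
  field_simp
  ring

/-! ## v4: the algebra of the Fredholm count (MECHANISM.md §11, Theorem M7 / Prop. 11.6)

Theorem M7 itself (Fredholm property and index of the linearised profile map on Hölder-type spaces)
is proved in MECHANISM.md §11.5 with pen and paper and is not typed here.  What follows is only its
bookkeeping and the one algebraic identity on which Prop. 11.6(ii) turns. -/

/-- The index of the local transport operator `L^{loc} = a g ∂ + (1 - Hf)` on `X^{k,β} → Y^{k,β}` at a
smooth profile of origin exponent `q₀ = 1` and antipodal order `P` (MECHANISM.md Theorem M7(a)):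
`1 - [k ≥ 1] - [k ≥ P]` (Iverson brackets).  A definition recording the formula, not a theorem about
operators. -/
def indexLloc (k P : ℕ) : ℤ := 1 - (if 1 ≤ k then 1 else 0) - (if P ≤ k then 1 else 0)

/-- The full linearisation in `(φ, a)` has index one more (bordering by `∂_a F = g f'`). -/
def indexFull (k P : ℕ) : ℤ := indexLloc k P + 1

/-- M7(b), the three regimes for `P ≥ 3`: index `(+1,+2)` at `k = 0`, `(0,+1)` for `1 ≤ k ≤ P-1`,
`(-1,0)` for `k ≥ P`; in particular the index drops by exactly one when `k` crosses `P`. -/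
theorem indexLloc_drop_at_antipode {P : ℕ} (hP : 3 ≤ P) :
    indexLloc 0 P = 1 ∧ (∀ k, 1 ≤ k → k < P → indexLloc k P = 0) ∧ (∀ k, P ≤ k → indexLloc k P = -1) ∧
    indexFull (P - 1) P = 1 ∧ indexFull P P = 0 := by
  refine ⟨?_, ?_, ?_, ?_, ?_⟩
  · simp [indexLloc]; omega
  · intro k hk hkP
    have h2 : ¬ (P ≤ k) := by omega
    simp [indexLloc, hk, h2]
  · intro k hk
    have h1 : 1 ≤ k := by omega
    simp [indexLloc, hk, h1]
  · have h1 : 1 ≤ P - 1 := by omega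
    have h2 : ¬ (P ≤ P - 1) := by omega
    simp [indexFull, indexLloc, h1, h2]
  · have h1 : 1 ≤ P := by omega
    simp [indexFull, indexLloc, h1]

/-- Prop. 11.6(ii), the algebra: at a rung (`1 - aP = 1/H`, `H = Hf(π) ≠ 0`, `a ≠ 0`, `C ≠ 0`) the
antipodal residue of the effective right-hand side, `u_P = ρ / w̃_π(0)` with
`ρ = C·(-P·H + (1 - aP)·H')` and `w̃_π(0) = a·C·H` (`H' = Hḟ(π)`), equals
`ṗ = -P/a + H'/(a H²)`. -/
theorem residue_eq_pdot (a P H H' C : ℝ) (ha : a ≠ 0) (hH : H ≠ 0) (hC : C ≠ 0)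
    (hquant : 1 - a * P = 1 / H) :
    C * (-P * H + (1 - a * P) * H') / (a * C * H) = -P / a + H' / (a * H ^ 2) := by
  rw [hquant]
  field_simp


/-! ### v5 — analyticity at the rungs (MECHANISM.md §12: Lemma 12.2, Theorem M8, Corollary M9)

Proved in MECHANISM.md §12 with pen and paper, NOT kernel-checked.  Under (H), `f` and `Hf` are
real-analytic at every point where `g ≠ 0` (Lemma 12.2): multiplying (T1) by `4i` and writing it for
`v = 2f`, `w = 2ig` gives `a w v' = v (w' - 2i)` with `w' = 2iHf = 2𝔉 - v`, where
`𝔉 = f + iHf = Σ_{k≥1} 2 f̂_k e^{ikx}` is holomorphic in the upper half-plane — an ODE in the complex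
domain with one holomorphic coefficient and real Cauchy data (H. Lewy's device); a Picard iteration on a
half-disc plus Painlevé's theorem continues `f - iHf` across the axis.  At the antipode, with
`𝒲 = ζλ`, `𝒱 = ζ^p μ` (`p ∈ ℕ`), the equation is a Briot–Bouquet system whose equilibrium condition
is the indicial law (`indicialQ_zero_iff`) and whose linearisation has eigenvalues `-1, 0`; a weighted
contraction from the corner of the half-disc and a Grönwall argument on the diameter give Theorem M8:
`p ∈ 2ℕ+1` ⇒ `f`, `Hf` real-analytic on an arc around `π` (oddness enters once: the one-sided data
`2C` and `-2C e^{-iπp}` agree iff `p` is odd, `sideRatio_eq_one_iff_odd`).  Corollary M9: for a solution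
whose stagnation set is `πℤ` with `Hf(0) ≠ 0 ≠ Hf(π)`, `C^∞ ⇔ C^ω ⇔` both exponents odd. -/

/-- The indicial exponent at the origin, `q₀ = (1 - 1/Hf(0))/a` (MECHANISM.md §2.3). -/
def originExponent (a : ℝ) (c : ℤ → ℂ) : ℝ := (1 - 1 / HfR c 0) / a

/-- **Lemma 12.2 (regular points — Lewy)** — proved in MECHANISM.md §12.2, not kernel-checked.
Under `ProfileHyp`, `f` and `Hf` are real-analytic at every `x` with `g(x) ≠ 0`. -/
def InteriorAnalyticStatement : Prop :=
  ∀ (a : ℝ) (c : ℤ → ℂ), ProfileHyp a c →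
    ∀ x : ℝ, gR c x ≠ 0 → AnalyticAt ℝ (fR c) x ∧ AnalyticAt ℝ (HfR c) x

/-- **Theorem M8 (odd exponent ⇒ real-analytic at the antipode)** — proved in MECHANISM.md §12.6,
not kernel-checked.  Under `ProfileHyp`, if `p(a) ∈ 2ℕ+1` then `f` and `Hf` are real-analytic on
an arc around `π`. -/
def M8Statement : Prop :=
  ∀ (a : ℝ) (c : ℤ → ℂ), ProfileHyp a c →
    (∃ n : ℕ, antipodalExponent a c = 2 * (n : ℝ) + 1) →
    ∃ ε : ℝ, 0 < ε ∧ AnalyticOnNhd ℝ (fR c) (nearPi ε) ∧ AnalyticOnNhd ℝ (HfR c) (nearPi ε)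

/-- **Theorem M8, equivalence form** (together with M1 (ii) and M2) — MECHANISM.md §12.6, not
kernel-checked: under `ProfileHyp`, `f` is `C^∞` on some arc around `π` iff `f` is real-analytic on
some arc around `π` (iff `p(a)` is odd: `M1OddStatement`, `M2Statement`). -/
def M8IffStatement : Prop :=
  ∀ (a : ℝ) (c : ℤ → ℂ), ProfileHyp a c →
    ((∃ ε : ℝ, 0 < ε ∧ ContDiffOn ℝ (⊤ : ℕ∞) (fR c) (nearPi ε)) ↔
      ∃ ε : ℝ, 0 < ε ∧ AnalyticOnNhd ℝ (fR c) (nearPi ε))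

/-- **Corollary M9 (smooth ⇔ analytic ⇔ quantised)** — proved in MECHANISM.md §12.7, not
kernel-checked.  Under `ProfileHyp`, if the zero set of `g` is exactly `πℤ` (on the circle: `{0, π}`)
and `Hf(0) ≠ 0`, then `f ∈ C^∞(ℝ) ↔ f` is real-analytic on `ℝ`, and the latter holds iff both
indicial exponents `p = (1 - 1/Hf(π))/a` and `q₀ = (1 - 1/Hf(0))/a` are odd positive integers. -/
def M9Statement : Prop :=
  ∀ (a : ℝ) (c : ℤ → ℂ), ProfileHyp a c →
    (∀ x : ℝ, gR c x = 0 ↔ ∃ k : ℤ, x = k * Real.pi) → HfR c 0 ≠ 0 →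
    (ContDiff ℝ (⊤ : ℕ∞) (fR c) ↔ AnalyticOnNhd ℝ (fR c) univ) ∧
    (AnalyticOnNhd ℝ (fR c) univ ↔
      (∃ n : ℕ, antipodalExponent a c = 2 * (n : ℝ) + 1) ∧
        ∃ m : ℕ, originExponent a c = 2 * (m : ℝ) + 1)

/-- The v5 mechanism statement: the v2 conjunction together with analyticity (Lemma 12.2, M8, M9). -/
def MechanismStatementV5 : Prop :=
  MechanismStatement ∧ InteriorAnalyticStatement ∧ M8Statement ∧ M8IffStatement ∧ M9Statement

/-- **(12.6), kernel-checked algebra.**  The equilibrium condition `Q(0; λ₀, μ) = 0` of the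
Briot–Bouquet system `(S_p)` of MECHANISM.md §12.3 reads `(η - 1)/(a η) - p = 0` with `η = Hf(π)`;
it holds iff `p` is the antipodal indicial exponent `(1 - 1/η)/a` — the indicial law (2.2) once more. -/
theorem indicialQ_zero_iff (a η p : ℝ) (ha : a ≠ 0) (hη : η ≠ 0) :
    (η - 1) / (a * η) - p = 0 ↔ p = (1 - 1 / η) / a := by
  have key : (η - 1) / (a * η) = (1 - 1 / η) / a := by
    field_simp
  constructor
  · intro h
    linarith [key]
  · intro h
    rw [h, ← key]
    ring

/-- **(12.9), kernel-checked algebra.**  For an integer exponent `p`, the one-sided data of the real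
profile in the weighted unknown `μ = 2F/ζ^p` are `μ(0+) = 2C` and `μ(0-) = -2C e^{-iπp} = -2C(-1)^p`
(`F = C sgn(y)|y|^p E`); their ratio `-(-1)^p` equals `1` — one datum for both sides of `π`, which is
what Lemma 12.5 needs — iff `p` is odd. -/
theorem sideRatio_eq_one_iff_odd (p : ℕ) : -((-1 : ℝ) ^ p) = 1 ↔ Odd p := by
  rcases Nat.even_or_odd p with h | h
  · rw [h.neg_one_pow]
    constructor
    · intro h1
      norm_num at h1
    · intro ho
      exact absurd h (Nat.not_even_iff_odd.mpr ho)
  · rw [h.neg_one_pow]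
    simp [h]

/-! ## v6 (gen 7): analyticity on the line and through the point at infinity (MECHANISM.md §13)

In LSS's chart `q = 2 arctan ξ` the complexified similarity equation reads
`𝒲' = 2iα + a(2𝔉♭ - 𝒱) - tan(q/2)𝒲`, `𝒲 𝒱' = 𝒱(2𝔉♭ - 𝒱 - 2i)` with `𝔉♭ = f + i h` the analytic
projection (holomorphic inside the disc), `𝒱 = 2f`, `𝒲 = 2iT`.  Lemma 13.3: `f`, `Hf` are real-analytic
at every `q ∈ (-π, π)` with `T(q) ≠ 0`.  At the origin (exponent `q₀ = (h(0) - 1)/(α + a h(0))`,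
Prop. 13.4) and at `q = π` (the point at infinity, exponent `1/α`; unknowns `g(π + ζ) = ζγ`,
`2f(π + ζ) = ζ^s μ`, `𝔉♭ = ζ²𝔈`, Prop. 13.5) the abstract one-sided Briot–Bouquet lemma 13.2
(equilibria along the whole `μ`-axis — the indicial law, `indicialQinf_zero_iff` —, eigenvalues
`{-1, 0}`, weighted contraction from the corner of a half-disc, saddle-type uniqueness on the diameter)
identifies the real profile with a holomorphic solution on both sides iff the exponent is odd.
Theorem M10: `1/α ∈ {3,5,7,…}` or `(α, a) = (1, 0)` ⇒ `f`, `Hf` real-analytic on an arc around `π`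
(`Φ` real-analytic through infinity); with M5/M6, `C^∞` near `π` ⇔ analytic near `π`.  Corollary M11:
if `T` vanishes on `(-π, π)` only at `0` and `T'(0) = α + a h(0) ≠ 0`, then `f ∈ C^∞(ℝ/2πℤ) ⇔ f`
real-analytic `⇔ q₀` odd and (`1/α` odd `≥ 3` or `(α, a) = (1, 0)`); on `(-π, π)` alone, analytic
`⇔ q₀` odd.  All proved in MECHANISM.md §13 with pen and paper, NOT kernel-checked; Corollary 13.8
(Huang–Qin–Wang–Wei's `c_l > 0` profiles) is not typed here. -/

/-- The indicial exponent at the origin of the line, `q₀ = (h(0) - 1)/(α + a h(0))` with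
`h(0) = Hf(0) - Hf(π)` (`= H_ℝΦ(0)`); MECHANISM.md Prop. 13.4, Lemma 10.2 Remark (2). -/
def lineOriginExponent (α a : ℝ) (c : ℤ → ℂ) : ℝ := (hLine c 0 - 1) / (α + a * hLine c 0)

/-- **Lemma 13.3 (regular points of the line — Lewy)** — proved in MECHANISM.md §13.3, not
kernel-checked.  Under `LineChartHyp`, `f` and `Hf` are real-analytic at every `q ∈ (-π, π)` at which
the transport coefficient `T = α sin q + a(1 + cos q) g` does not vanish. -/
def LineInteriorAnalyticStatement : Prop :=
  ∀ (α a : ℝ) (c : ℤ → ℂ), LineChartHyp α a c →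
    ∀ q : ℝ, -Real.pi < q → q < Real.pi → transportLine α a c q ≠ 0 →
      AnalyticAt ℝ (fR c) q ∧ AnalyticAt ℝ (HfR c) q

/-- **Proposition 13.4 (c) (the origin of the line)** — proved in MECHANISM.md §13.4, not
kernel-checked.  Under `LineChartHyp`, if `T'(0) = α + a h(0) ≠ 0`, `f ≢ 0` on right neighbourhoods
of `0`, and `q₀ ∈ 2ℕ+1`, then `f` and `Hf` are real-analytic on a neighbourhood of `0`
(in particular whenever `f ∈ C¹` near `0` with `f'(0) ≠ 0`, i.e. `q₀ = 1`). -/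
def OriginLineStatement : Prop :=
  ∀ (α a : ℝ) (c : ℤ → ℂ), LineChartHyp α a c →
    α + a * hLine c 0 ≠ 0 →
    (∀ δ : ℝ, 0 < δ → ∃ y : ℝ, 0 < y ∧ y < δ ∧ fR c y ≠ 0) →
    (∃ n : ℕ, lineOriginExponent α a c = 2 * (n : ℝ) + 1) →
    ∃ ε : ℝ, 0 < ε ∧ AnalyticOnNhd ℝ (fR c) (Ioo (-ε) ε) ∧ AnalyticOnNhd ℝ (HfR c) (Ioo (-ε) ε)

/-- **Theorem M10 (A) (odd mirror rung ⇒ real-analytic through infinity)** — proved in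
MECHANISM.md §13.6, not kernel-checked.  Under `LineChartHyp`, if `1/α ∈ {3, 5, 7, …}` or
`(α, a) = (1, 0)`, then `f` and `Hf` are real-analytic on an arc around `q = π`, i.e. `Φ` and
`H_ℝΦ` are real-analytic through the point at infinity of `ℝP¹`.  Upgrades `M5OddStatement`. -/
def M10Statement : Prop :=
  ∀ (α a : ℝ) (c : ℤ → ℂ), LineChartHyp α a c →
    ((∃ n : ℕ, 1 / α = 2 * (n : ℝ) + 3) ∨ (α = 1 ∧ a = 0)) →
    ∃ ε : ℝ, 0 < ε ∧ AnalyticOnNhd ℝ (fR c) (nearPi ε) ∧ AnalyticOnNhd ℝ (HfR c) (nearPi ε)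

/-- **Theorem M10 (B), equivalence form** (with M5 and M6) — MECHANISM.md §13.6, not kernel-checked:
under `LineChartHyp`, `f` is `C^∞` on some arc around `π` iff `f` is real-analytic on some arc around
`π` (iff `1/α` is odd `≥ 3` or `(α, a) = (1, 0)`: `M5OddStatement`, `M6Statement`). -/
def M10IffStatement : Prop :=
  ∀ (α a : ℝ) (c : ℤ → ℂ), LineChartHyp α a c →
    ((∃ ε : ℝ, 0 < ε ∧ ContDiffOn ℝ (⊤ : ℕ∞) (fR c) (nearPi ε)) ↔
      ∃ ε : ℝ, 0 < ε ∧ AnalyticOnNhd ℝ (fR c) (nearPi ε))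

end Summit.NavierStokesRegularity.OSWSelfSimilar.Mechanism
end
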